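import Summits.HodgeConjecture.HodgeConjecture.Theorems.PadicSemiregularLiftFermatAnchorAssemblyGMFDefs

/-!
# Base change, twist and shift of LAWFUL graded matrix factorizations (line `witt-lift-rigid-mf`)

Route `PadicSemiregularLift` of `HodgeConjecture`; crux `FermatAnchorAssembly` (stmt-HodgeConjecture-14874),
line `witt-lift-rigid-mf`, vocabulary `Theorems/PadicSemiregularLiftFermatAnchorAssemblyGMFDefs.lean`.
The vocabulary defines `GMFData.map` (base change of the DATA along a ring map), `GMFData.twist`
(pull-back `g^*N` along `xᵢ ↦ ζ^{⟨gᵢ⟩} xᵢ`) and `GMFData.shift` (`N[1]`), but not their lifts to LAWFUL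
factorizations `GMF` (bihomogeneous entries, `φψ = ψφ = (Σ xᵢᵐ) · 1`). This file supplies them:

* `IsBihom.map`, `IsBihom.diagTwist` — bihomogeneity survives any coefficient-support-shrinking operation
  (`MvPolynomial.support_map_subset`; `GMFData.coeff_diagTwist`: the diagonal substitution rescales each
  coefficient, `coeff_e (g^* q) = (∏ᵢ ζ^{⟨gᵢ⟩ eᵢ}) · coeff_e q`);
* `map_fermatForm`, `GMFData.diagTwist_fermatForm` (`ζᵐ = 1`) — the Fermat form is preserved;
* `GMF.baseChange g M` (used by `stub_eulerBaseChange`: `N := M_W ⊗ Frac 𝕎`, `M := M_W ⊗ 𝕜`),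
  `GMF.twist τ hτ g M` (`τᵐ = 1`), `GMF.shift M` — lawful, with `toGMFData` the data-level operation
  (`rfl`);
* the commutation rules `GMFData.twist_map` (`(g_* M)` twisted by `g τ` is `g_*` of `M` twisted by `τ`),
  `GMFData.shift_map`, `GMFData.map_map`.

Everything is `[folklore]` bookkeeping over `Matrix.map` / `MvPolynomial.map` / `MvPolynomial.aeval`; no
named fact, no `sorry`. Deliberately NOT here: anything about `homDim` / `eulerForm` (the Euler-form
base-change invariance is the residual content of `stub_eulerBaseChange` and lives in its own file).
-/

-- `Summit.HodgeConjecture.HodgeConjecture.…` is the tree's mandated summit/problem namespace (single-problem summit).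
set_option linter.dupNamespace false

noncomputable section

open Finset

namespace Summit.HodgeConjecture.HodgeConjecture.Cruxes.FermatAnchorAssembly.WittLiftRigidMf

/-! ### Bihomogeneity under support-shrinking operations -/

/-- Bihomogeneity only constrains the support: it passes to any polynomial with smaller support. [folklore] -/
theorem IsBihom.of_support_subset {R S : Type} [CommSemiring R] [CommSemiring S] {ν m : ℕ}
    {L : AddSubgroup (Fin ν → ZMod m)} {q : MvPolynomial (Fin ν) R} {q' : MvPolynomial (Fin ν) S}
    {d : ℤ} {c : Fin ν → ZMod m} (h : IsBihom m L q d c) (hs : q'.support ⊆ q.support) :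
    IsBihom m L q' d c :=
  fun e he ↦ h e (hs he)

/-- Bihomogeneity is preserved by any change of coefficients (`MvPolynomial.support_map_subset`). [folklore] -/
theorem IsBihom.map {R S : Type} [CommSemiring R] [CommSemiring S] {ν m : ℕ}
    {L : AddSubgroup (Fin ν → ZMod m)} {q : MvPolynomial (Fin ν) R} {d : ℤ} {c : Fin ν → ZMod m}
    (h : IsBihom m L q d c) (g : R →+* S) : IsBihom m L (MvPolynomial.map g q) d c :=
  h.of_support_subset (MvPolynomial.support_map_subset g q)

/-- The Fermat form is defined over `ℕ`: it is preserved by every change of coefficients. [folklore] -/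
theorem map_fermatForm {R S : Type} [CommSemiring R] [CommSemiring S] (g : R →+* S) (ν m : ℕ) :
    MvPolynomial.map g (fermatForm R ν m) = fermatForm S ν m := by
  simp [fermatForm, map_sum, map_pow, MvPolynomial.map_X]

/-- A scalar matrix `f · 1` of polynomials maps to the scalar matrix `F f · 1` under an entrywise ring
map `F`. [folklore] -/
theorem smul_one_map {A B ι : Type} [Semiring A] [Semiring B] [DecidableEq ι] (F : A →+* B) (f : A) :
    (f • (1 : Matrix ι ι A)).map F = F f • (1 : Matrix ι ι B) := by
  ext i j
  by_cases h : i = j <;> simp [h]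

namespace GMFData

variable {R S T : Type} [CommRing R] [CommRing S] [CommRing T] {ν m : ℕ} {ι₀ ι₁ : Type}

/-- The diagonal substitution on a monomial: `x^e ↦ (∏ᵢ (ζ^{⟨gᵢ⟩})^{eᵢ}) x^e`. [folklore] -/
theorem diagTwist_monomial (ζ : R) (g : Fin ν → ZMod m) (s : Fin ν →₀ ℕ) (a : R) :
    diagTwist ζ g (MvPolynomial.monomial s a) =
      MvPolynomial.monomial s (a * s.prod fun i k ↦ (ζ ^ (g i).val) ^ k) := by
  simp only [diagTwist, AlgHom.toRingHom_eq_coe, RingHom.coe_coe, MvPolynomial.aeval_monomial,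
    MvPolynomial.algebraMap_eq]
  simp_rw [mul_pow, ← map_pow]
  rw [Finsupp.prod_mul, MvPolynomial.monomial_eq, map_mul]
  have hC : (s.prod fun i k ↦ MvPolynomial.C (σ := Fin ν) ((ζ ^ (g i).val) ^ k)) =
      MvPolynomial.C (s.prod fun i k ↦ (ζ ^ (g i).val) ^ k) := by
    simp only [Finsupp.prod, map_prod]
  rw [hC]
  ring

/-- The diagonal substitution rescales coefficients: `coeff_e (g^*q) = (∏ᵢ (ζ^{⟨gᵢ⟩})^{eᵢ}) coeff_e q`. [folklore] -/
theorem coeff_diagTwist (ζ : R) (g : Fin ν → ZMod m) (q : MvPolynomial (Fin ν) R) (e : Fin ν →₀ ℕ) :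
    (diagTwist ζ g q).coeff e = (e.prod fun i k ↦ (ζ ^ (g i).val) ^ k) * q.coeff e := by
  induction q using MvPolynomial.induction_on' with
  | monomial s a =>
    classical
    rw [diagTwist_monomial, MvPolynomial.coeff_monomial, MvPolynomial.coeff_monomial]
    by_cases h : s = e
    · subst h; simp [mul_comm]
    · simp [h]
  | add p q hp hq => rw [map_add, MvPolynomial.coeff_add, MvPolynomial.coeff_add, hp, hq, mul_add]

/-- The diagonal substitution shrinks supports. [folklore] -/
theorem support_diagTwist_subset (ζ : R) (g : Fin ν → ZMod m) (q : MvPolynomial (Fin ν) R) :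
    (diagTwist ζ g q).support ⊆ q.support := by
  intro e he
  rw [MvPolynomial.mem_support_iff] at he ⊢
  rw [coeff_diagTwist] at he
  exact fun h ↦ he (by rw [h, mul_zero])

/-- Bihomogeneity is preserved by the diagonal substitution `xᵢ ↦ ζ^{⟨gᵢ⟩} xᵢ`. [folklore] -/
theorem _root_.Summit.HodgeConjecture.HodgeConjecture.Cruxes.FermatAnchorAssembly.WittLiftRigidMf.IsBihom.diagTwist
    {L : AddSubgroup (Fin ν → ZMod m)} {q : MvPolynomial (Fin ν) R} {d : ℤ} {c : Fin ν → ZMod m}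
    (h : IsBihom m L q d c) (ζ : R) (g : Fin ν → ZMod m) : IsBihom m L (diagTwist ζ g q) d c :=
  h.of_support_subset (support_diagTwist_subset ζ g q)

/-- The diagonal substitution on a variable: `xᵢ ↦ ζ^{⟨gᵢ⟩} xᵢ`. [folklore] -/
theorem diagTwist_X (ζ : R) (g : Fin ν → ZMod m) (i : Fin ν) :
    diagTwist ζ g (MvPolynomial.X i) = MvPolynomial.C (ζ ^ (g i).val) * MvPolynomial.X i := by
  simp [diagTwist]

/-- For `ζᵐ = 1` the diagonal substitution fixes the Fermat form `Σ xᵢᵐ`. [folklore] -/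
theorem diagTwist_fermatForm (ζ : R) (hζ : ζ ^ m = 1) (g : Fin ν → ZMod m) :
    diagTwist ζ g (fermatForm R ν m) = fermatForm R ν m := by
  simp only [fermatForm, map_sum]
  refine Finset.sum_congr rfl fun i _ ↦ ?_
  rw [map_pow, diagTwist_X, mul_pow, ← map_pow, pow_right_comm, hζ, one_pow, map_one, one_mul]

/-- Base change and the diagonal substitution commute: `g_* ∘ (twist by τ) = (twist by g τ) ∘ g_*`. [folklore] -/
theorem map_comp_diagTwist (g : R →+* S) (τ : R) (h : Fin ν → ZMod m) :
    (MvPolynomial.map g).comp (diagTwist τ h) = (diagTwist (g τ) h).comp (MvPolynomial.map g) := by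
  apply MvPolynomial.ringHom_ext
  · intro r
    simp [diagTwist]
  · intro i
    simp [diagTwist, MvPolynomial.map_X, map_mul, MvPolynomial.map_C, map_pow]

/-- `g_*(τ-twist of M) = (g τ)-twist of g_* M` on data. [folklore] -/
theorem twist_map (g : R →+* S) (τ : R) (h : Fin ν → ZMod m) (M : GMFData R ν m ι₀ ι₁) :
    (M.map g).twist (g τ) h = (M.twist τ h).map g := by
  have key : ((diagTwist (g τ) h) ∘ (MvPolynomial.map g) :
      MvPolynomial (Fin ν) R → MvPolynomial (Fin ν) S) = (MvPolynomial.map g) ∘ (diagTwist τ h) := by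
    have := congrArg (fun F : MvPolynomial (Fin ν) R →+* MvPolynomial (Fin ν) S ↦ (F : _ → _))
      (map_comp_diagTwist g τ h)
    simpa [RingHom.coe_comp] using this.symm
  simp only [GMFData.map, GMFData.twist, Matrix.map_map, key]

/-- Base change commutes with the shift (definitionally). [folklore] -/
theorem shift_map (g : R →+* S) (M : GMFData R ν m ι₀ ι₁) : (M.map g).shift = M.shift.map g := rfl

/-- Base change is functorial. [folklore] -/
theorem map_map (g : R →+* S) (g' : S →+* T) (M : GMFData R ν m ι₀ ι₁) :
    (M.map g).map g' = M.map (g'.comp g) := by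
  have key : ((MvPolynomial.map g') ∘ (MvPolynomial.map g) :
      MvPolynomial (Fin ν) R → MvPolynomial (Fin ν) T) = MvPolynomial.map (g'.comp g) := by
    funext q
    exact MvPolynomial.map_map g g' q
  simp only [GMFData.map, Matrix.map_map, key]

end GMFData

/-! ### Lawful base change, twist and shift -/

namespace GMF

variable {R S : Type} [CommRing R] [CommRing S] {ν m : ℕ} {L : AddSubgroup (Fin ν → ZMod m)}
  {ι₀ ι₁ : Type} [Fintype ι₀] [Fintype ι₁] [DecidableEq ι₀] [DecidableEq ι₁]

/-- **Base change of a lawful `L`-graded factorization along a ring map is lawful** (supports shrink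
under `MvPolynomial.map`; `Matrix.map` of a ring map is multiplicative; `Σ xᵢᵐ ↦ Σ xᵢᵐ`). For
`stub_eulerBaseChange`: `M_W ⊗ Frac 𝕎 𝕜` and `M_W ⊗ 𝕜` are `M_W.baseChange (algebraMap _ _)` and
`M_W.baseChange constantCoeff`. [folklore] -/
def baseChange (g : R →+* S) (M : GMF R ν m L ι₀ ι₁) : GMF S ν m L ι₀ ι₁ where
  toGMFData := M.toGMFData.map g
  φ_bihom i j := (M.φ_bihom i j).map g
  ψ_bihom j i := (M.ψ_bihom j i).map g
  φ_mul_ψ := by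
    change M.φ.map (MvPolynomial.map g) * M.ψ.map (MvPolynomial.map g) = _
    rw [← Matrix.map_mul, M.φ_mul_ψ, smul_one_map, map_fermatForm]
  ψ_mul_φ := by
    change M.ψ.map (MvPolynomial.map g) * M.φ.map (MvPolynomial.map g) = _
    rw [← Matrix.map_mul, M.ψ_mul_φ, smul_one_map, map_fermatForm]

/-- The data of the base change is the base change of the data. [folklore] -/
@[simp] theorem baseChange_toGMFData (g : R →+* S) (M : GMF R ν m L ι₀ ι₁) :
    (M.baseChange g).toGMFData = M.toGMFData.map g := rfl

/-- **The pull-back `g^*M` of a lawful factorization along `xᵢ ↦ τ^{⟨gᵢ⟩} xᵢ` is lawful when `τᵐ = 1`**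
(the substitution preserves bidegrees of monomials and fixes `Σ xᵢᵐ`). [folklore] -/
def twist (τ : R) (hτ : τ ^ m = 1) (g : Fin ν → ZMod m) (M : GMF R ν m L ι₀ ι₁) : GMF R ν m L ι₀ ι₁ where
  toGMFData := M.toGMFData.twist τ g
  φ_bihom i j := (M.φ_bihom i j).diagTwist τ g
  ψ_bihom j i := (M.ψ_bihom j i).diagTwist τ g
  φ_mul_ψ := by
    change M.φ.map (GMFData.diagTwist τ g) * M.ψ.map (GMFData.diagTwist τ g) = _
    rw [← Matrix.map_mul, M.φ_mul_ψ, smul_one_map, GMFData.diagTwist_fermatForm τ hτ]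
  ψ_mul_φ := by
    change M.ψ.map (GMFData.diagTwist τ g) * M.φ.map (GMFData.diagTwist τ g) = _
    rw [← Matrix.map_mul, M.ψ_mul_φ, smul_one_map, GMFData.diagTwist_fermatForm τ hτ]

/-- The data of the lawful twist is the twist of the data. [folklore] -/
@[simp] theorem twist_toGMFData (τ : R) (hτ : τ ^ m = 1) (g : Fin ν → ZMod m) (M : GMF R ν m L ι₀ ι₁) :
    (M.twist τ hτ g).toGMFData = M.toGMFData.twist τ g := rfl

/-- **The shift `M[1]` of a lawful factorization is lawful** (the bidegree labels of `GMFData.shift` are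
made for this: `φ' = ψ`, `ψ' = φ`, degrees of `F⁰'` dropped by `m`). [folklore] -/
def shift (M : GMF R ν m L ι₀ ι₁) : GMF R ν m L ι₁ ι₀ where
  toGMFData := M.toGMFData.shift
  φ_bihom l k := by
    have h := M.ψ_bihom l k
    change IsBihom m L (M.ψ l k) (M.d₀ k - (M.d₁ l - m)) (M.c₀ k - M.c₁ l)
    convert h using 1
    ring
  ψ_bihom k l := by
    have h := M.φ_bihom k l
    change IsBihom m L (M.φ k l) (M.d₁ l - m + m - M.d₀ k) (M.c₁ l - M.c₀ k)
    convert h using 1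
    ring
  φ_mul_ψ := M.ψ_mul_φ
  ψ_mul_φ := M.φ_mul_ψ

/-- The data of the lawful shift is the shift of the data. [folklore] -/
@[simp] theorem shift_toGMFData (M : GMF R ν m L ι₀ ι₁) : M.shift.toGMFData = M.toGMFData.shift := rfl

/-- Base change commutes with the lawful twist. [folklore] -/
theorem baseChange_twist (g : R →+* S) (τ : R) (hτ : τ ^ m = 1) (h : Fin ν → ZMod m)
    (M : GMF R ν m L ι₀ ι₁) :
    ((M.twist τ hτ h).baseChange g).toGMFData =
      ((M.baseChange g).twist (g τ) (by rw [← map_pow, hτ, map_one]) h).toGMFData := by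
  simp [GMFData.twist_map]

end GMF

/-! ### Registered sub-goals (∀-form): lawful factorizations are stable under base change, twist, shift -/

/-- **Sub-goal H2 of `stub_eulerBaseChange`: the base change of a lawful `L`-graded factorization of
`Σ xᵢᵐ` along any ring map is (the data of) a lawful one.** [folklore] -/
theorem exists_lawful_baseChange : ∀ (R S : Type) [CommRing R] [CommRing S] (ν m : ℕ)
    (L : AddSubgroup (Fin ν → ZMod m)) (ι₀ ι₁ : Type) [Fintype ι₀] [Fintype ι₁] [DecidableEq ι₀]
    [DecidableEq ι₁] (g : R →+* S) (M : GMF R ν m L ι₀ ι₁),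
    ∃ N : GMF S ν m L ι₀ ι₁, N.toGMFData = M.toGMFData.map g :=
  fun _ _ _ _ _ _ _ _ _ _ _ _ _ g M ↦ ⟨M.baseChange g, rfl⟩

/-- **The pull-back `g^*M` of a lawful factorization by an `m`-th root of unity `τ` is (the data of) a
lawful one.** [folklore] -/
theorem exists_lawful_twist : ∀ (R : Type) [CommRing R] (ν m : ℕ) (L : AddSubgroup (Fin ν → ZMod m))
    (ι₀ ι₁ : Type) [Fintype ι₀] [Fintype ι₁] [DecidableEq ι₀] [DecidableEq ι₁] (τ : R), τ ^ m = 1 →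
    ∀ (g : Fin ν → ZMod m) (M : GMF R ν m L ι₀ ι₁),
    ∃ N : GMF R ν m L ι₀ ι₁, N.toGMFData = M.toGMFData.twist τ g :=
  fun _ _ _ _ _ _ _ _ _ _ _ τ hτ g M ↦ ⟨M.twist τ hτ g, rfl⟩

/-- **The shift `M[1]` of a lawful factorization is (the data of) a lawful one.** [folklore] -/
theorem exists_lawful_shift : ∀ (R : Type) [CommRing R] (ν m : ℕ) (L : AddSubgroup (Fin ν → ZMod m))
    (ι₀ ι₁ : Type) [Fintype ι₀] [Fintype ι₁] [DecidableEq ι₀] [DecidableEq ι₁] (M : GMF R ν m L ι₀ ι₁),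
    ∃ N : GMF R ν m L ι₁ ι₀, N.toGMFData = M.toGMFData.shift :=
  fun _ _ _ _ _ _ _ _ _ _ _ M ↦ ⟨M.shift, rfl⟩

end Summit.HodgeConjecture.HodgeConjecture.Cruxes.FermatAnchorAssembly.WittLiftRigidMf

end
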